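import Summits.SmoothPoincare4.SmoothPoincare4.Theorems.EntropyRungSubcylindricalExistenceTransport
import HarnessLib

/-!
# `SmoothPoincare4 → RicciFat.RicciFatSphere` (route RicciFat, support item stmt-SmoothPoincare4-5193)

The consistency / normalisation statement `Spc4ImpliesRicciFatSphere` of route RicciFat: if every
smooth homotopy 4-sphere is diffeomorphic to `S⁴`, then every closed smooth `M ≃ₕ S⁴` carries, for each
`δ > 0`, a `C^∞` Riemannian metric `h` with `Ric_h ≥ 3h` and `Vol(M, h) ≥ (1 − δ)·8π²/3` — pull the
round metric back along the diffeomorphism: `Ric = 3g`, `Vol = 8π²/3`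
(`exists_roundMetric_transport` of `EntropyRungSubcylindricalExistenceTransport.lean`: naturality of
the Ricci tensor `ricci_comap_apply`, `ricci_roundMetric_holds`, invariance of the Riemannian measure
under isometric diffeomorphisms, `riemannianMeasure_roundMetric_sphere_four_univ`). Everything is
proved (no `sorry`, no definition, no named fact).

References: [ONeill1983] Ch. 3, Prop. 3.59; [Federer1969] §2.10.11; [CheegerColding1997] (context).
-/

noncomputable section

-- the registered namespace `Summit.SmoothPoincare4.SmoothPoincare4.Theorems` repeats a component
set_option linter.dupNamespace false

open scoped Manifold ContDiff Topology ENNReal NNReal ContinuousMap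
open Set MeasureTheory
open Literature.Geometry.Lorentzian Literature.Geometry.Riemannian

namespace Summit.SmoothPoincare4.SmoothPoincare4.Theorems

/-- **`SmoothPoincare4 → RicciFat.RicciFatSphere`** (route RicciFat's consistency / normalisation item
stmt-SmoothPoincare4-5193, verbatim): pull the round metric back along the diffeomorphism — `Ric = 3g`
and `Vol = 8π²/3 ≥ (1 − δ)·8π²/3` for every `δ > 0`; the Mathlib Riemannian metric is
`g.toContMDiffRiemannianMetric hg`, whose pseudo-Riemannian metric `ofRiemannian` is `g` again.
[folklore] -/
theorem spc4ImpliesRicciFatSphere_proof :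
    _root_.Summit.SmoothPoincare4.SmoothPoincare4.Theses.RicciFat.Spc4ImpliesRicciFatSphere := by
  intro h M _ _ _ _ _ _ _ _ e δ hδ
  -- compact + T₂ ⇒ T₃ (Mathlib instance) feeds `riemannianMeasure`
  obtain ⟨Φ⟩ := h M ‹ChartedSpace (EuclideanSpace ℝ (Fin 4)) M› ‹IsManifold (𝓡 4) ∞ M› e
  obtain ⟨g, hLC, hg, hRic, hVol⟩ := exists_roundMetric_transport Φ
  -- the pseudo-Riemannian metric of the Mathlib Riemannian metric of `g` is `g` again
  have hback : PseudoRiemannianMetric.ofRiemannian (g.toContMDiffRiemannianMetric hg) = g := by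
    ext; rfl
  haveI hLC' : (PseudoRiemannianMetric.ofRiemannian (g.toContMDiffRiemannianMetric hg)).HasLeviCivita :=
    (PseudoRiemannianMetric.ofRiemannian _).hasLeviCivita
  -- `Ric ≥ 3g` passes along the equality of metrics (the Levi-Civita instance is a `Prop`)
  have hRic' : ∀ (g' : PseudoRiemannianMetric (𝓡 4) ∞ (EuclideanSpace ℝ (Fin 4)) (TangentSpace (𝓡 4) : M → Type _))
      [g'.HasLeviCivita], g' = g →
      ∀ (x : M) (v : TangentSpace (𝓡 4) x), 3 * g'.val x v v ≤ g'.ricci x v v := by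
    rintro g' _ rfl x v
    exact (hRic x v v).symm.le
  refine ⟨g.toContMDiffRiemannianMetric hg, hLC', fun x v ↦ hRic' _ hback x v, ?_⟩
  -- `Vol = 8π²/3 ≥ (1 − δ)·8π²/3`
  rw [hVol]
  exact ENNReal.ofReal_le_ofReal (by nlinarith [Real.pi_pos, sq_nonneg Real.pi])

end Summit.SmoothPoincare4.SmoothPoincare4.Theorems

end
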